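import Summits.FinalStateConjecture.FinalStateConjecture.Theorems.BartnikGapSettlingGapExhaustionConditionalMultiplierUniformOf
import Summits.FinalStateConjecture.FinalStateConjecture.Theorems.BartnikGapSettlingGapExhaustionZeroEnergyExactMarginUniform
import HarnessLib

/-!
# `KerrConditionalMultiplierUniform`: the quantitative `T`-CONDITIONAL pseudo-convexity of every
# Kerr cylinder beyond the horizon, UNIFORMLY over a compact set of subextremal labels
(crux `GapExhaustion`, stmt-FinalStateConjecture-10808, line photon-shell-pseudoconvexity;
stub (UU-T) `stub_kerrConditionalMultiplierU`, the label-uniform twin of the per-label §1d theorem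
`kerrConditionalMultiplierKS` / `Theorems.stub_kerrConditionalMultiplier_of`; lead c11, wave 4 —
the first bricks of the `T`-conditional extension S6b of the node, see `Cruxes/GapExhaustion/PLAN-S6b.md`)

The `T`-conditional extension of the Hawking field (S6b) sweeps outward through ALL cylinders
`{r = c}`, `c > r₊`, belt included: each is strongly pseudo-convex for the null vectors tangent to
it and ORTHOGONAL to the stationary field (zero Killing energy), which is condition (po3) of
Ionescu–Klainerman, Invent. Math. 175 (2009), Def. 3.1, with the stationary field as the
conditioning vector. This file composes the two landed label-uniform bricks:
* (UB-T) `stub_kerrZeroEnergyExactMarginU` — ONE exact-Kerr margin `m > 0` for the zero-energy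
  tangential null vectors, for all labels of a compact `K ⊆ {0 < M, |a| < M}` and all band points
  `r_lo(ℓ) ≤ r ≤ r_e(ℓ)`, `r₊(ℓ) < r_lo(ℓ) < r_e(ℓ)`;
* (UU-T-of) `stub_kerrConditionalMultiplierU_of_margin` — from such a margin, ONE pair `(δ, ε₁)`
  serving every `δ`-close chart and every vector field `T` `δ`-close to `∂₀` on the band.

References: A. D. Ionescu, S. Klainerman, Invent. Math. 175 (2009), Def. 3.1; JAMS 26 (2013),
Lemma 2.11 [IonescuKlainerman2013]; R. P. Kerr, A. Schild (1965), §§2–3 [KerrSchild1965].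
-/

noncomputable section

-- instance search through the nested operator types `E4 →L[ℝ] E4 →L[ℝ] E4 →L[ℝ] ℝ`
set_option maxSynthPendingDepth 3

-- D-0017: single-problem summit, `Summit.<S>.<S>.…` by design (cf. lakefile `weak.linter.dupNamespace`).
set_option linter.dupNamespace false

namespace Summit.FinalStateConjecture.FinalStateConjecture.Theorems

open Set Literature.Geometry.Lorentzian Literature.Geometry.Lorentzian.MetricCoord
open scoped Manifold ContDiff Topology ENNReal

/-- **Stub (UU-T) of the line `photon-shell-pseudoconvexity` (crux `GapExhaustion`,
stmt-FinalStateConjecture-10808) — Ionescu–Klainerman's QUANTITATIVE `T`-conditional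
pseudo-convexity (condition (po3) of Invent. Math. 175 (2009), Def. 3.1, conditioning vector the
stationary field) of EVERY Kerr cylinder beyond the horizon, `C²`-stable in the chart and stable
in `T`, UNIFORMLY over a compact set of subextremal labels.** For a compact
`K ⊆ {(M, a) | 0 < M, |a| < M}` and band radii `r_lo, r_e` continuous on `K` with
`r₊(ℓ) < r_lo(ℓ) < r_e(ℓ)` (no photon-shell restriction) there are `δ, ε₁ > 0` such that for
every `ℓ ∈ K`, every spacetime chart on `{ℓ.1 < r}` whose pulled-back components are `δ`-close in
`C²` sup norm to `g_ℓ` on the band, every vector field `T` on the chart `δ`-close to `∂₀` on the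
band, and every band point `z` (all times), some `μ`, `|μ| ≤ ε₁⁻¹`, satisfies
`ε₁²‖w‖² ≤ μ (Φ^*g)_z(w,w) − Hess r_z(w,w) + ε₁⁻²(((Φ^*g)_z(T z, w))² + dr_z(w)²)` for all `w`.
Composition of (UB-T) `stub_kerrZeroEnergyExactMarginU` and (UU-T-of)
`stub_kerrConditionalMultiplierU_of_margin`. [cite: IonescuKlainerman2013, Lemma 2.11] -/
theorem stub_kerrConditionalMultiplierU :
    ∀ (K : Set (ℝ × ℝ)) (r_lo r_e : ℝ × ℝ → ℝ), IsCompact K →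
      (∀ ℓ ∈ K, 0 < ℓ.1 ∧ |ℓ.2| < ℓ.1) → ContinuousOn r_lo K → ContinuousOn r_e K →
      (∀ ℓ ∈ K, Kerr.rPlus ℓ.1 ℓ.2 < r_lo ℓ ∧ r_lo ℓ < r_e ℓ) →
      ∃ (δ ε₁ : ℝ), 0 < δ ∧ 0 < ε₁ ∧ ∀ ℓ ∈ K,
      ∀ (𝓢 : Spacetime.{0} 4) (Φ : E4 → 𝓢.carrier) (T : E4 → E4),
        ContMDiffOn 𝓘(ℝ, E4) (𝓡 4) ∞ Φ {z | ℓ.1 < Kerr.radius ℓ.2 z} →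
        Topology.IsOpenEmbedding ({z : E4 | ℓ.1 < Kerr.radius ℓ.2 z}.restrict Φ) →
        supCkENorm {z | ℓ.1 < Kerr.radius ℓ.2 z ∧ r_lo ℓ ≤ Kerr.radius ℓ.2 z ∧ Kerr.radius ℓ.2 z ≤ r_e ℓ} 2
            (fun z => 𝓢.metricInCoords Φ z - Kerr.bilin ℓ.1 ℓ.2 z) ≤ ENNReal.ofReal δ →
        (∀ z : E4, r_lo ℓ ≤ Kerr.radius ℓ.2 z → Kerr.radius ℓ.2 z ≤ r_e ℓ →
          ‖T z - E4.basisVector 0‖ ≤ δ) →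
        ∀ z : E4, r_lo ℓ ≤ Kerr.radius ℓ.2 z → Kerr.radius ℓ.2 z ≤ r_e ℓ →
          ∃ μ : ℝ, |μ| ≤ ε₁⁻¹ ∧ ∀ w : E4,
            ε₁ ^ 2 * ‖w‖ ^ 2 ≤ μ * 𝓢.metricInCoords Φ z w w
              - hessAt (𝓢.metricInCoords Φ) (Kerr.radius ℓ.2) z w w
              + ε₁⁻¹ ^ 2 * ((𝓢.metricInCoords Φ z (T z) w) ^ 2
                + (fderiv ℝ (Kerr.radius ℓ.2) z w) ^ 2) := by
  intro K r_lo r_e hK hlab hloc hrec hband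
  obtain ⟨m, hm, hmargin⟩ := stub_kerrZeroEnergyExactMarginU K r_lo r_e hK hlab hloc hrec hband
  exact stub_kerrConditionalMultiplierU_of_margin K r_lo r_e m hK hlab hloc hrec
    (fun ℓ hℓ ↦ (hband ℓ hℓ).1) hm hmargin

end Summit.FinalStateConjecture.FinalStateConjecture.Theorems

end
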